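import Literature.NumberTheory.ComplexMultiplication.CMAlgebraTorusRosatiPolarization
import Literature.NumberTheory.NumberFields.CMExtensionsOfEveryDegree
import Literature.Geometry.Kaehler.ComplexTorusEndomorphismAlgebraProduct
import HarnessLib

/-!
# An isotypic CM torus `Bⁿ` has multiplication by a CM FIELD of full degree, stable under some Rosati involution
# (Milne, *Complex Multiplication*, Ch. I §3 Proposition 3.6 (b) — torus level)

Topic `Literature/NumberTheory/ComplexMultiplication`, namespace `Literature.NumberTheory.ComplexMultiplication`;
lane `lit-hodgefound` (Track 2 foundations library, Layer A3 skeleton seat `skel-3`, generation 55, row A3-G139, FILE 2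
of 2).  Sequel of `CMTorusStructureTheoremOrder` (the predicate `IsCMTorusRat P ρ`: a complex torus `X = E/P(ℤ^ι)` with a
`ℚ`-algebra homomorphism `ρ : K → End_ℚ(X) ⊆ M_ι(ℚ)` of a number field `K` with `[K : ℚ] = 2 dim X`), of
`Geometry/Kaehler/ComplexTorusEndomorphismAlgebraProduct` (the power torus `Xⁿ = ComplexTorus (powPeriod P n)` and
«`End_ℚ(Xⁿ)` equals the ring of `(n × n)`-matrices with entries in `End_ℚ(X)`»: `comp_mem_endAlgRat_pow_iff`), of
`CMAlgebraTorusRosatiPolarization` (p19: on every torus with multiplication by a CM-algebra of full degree there is a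
polarisation whose Rosati involution induces complex conjugation, `IsCMAlgTorusRat.exists_isRiemannForm_ratGram_rosati_eq_piComplexConj`),
of `CMAlgebraTorusStructureTheorem` (`IsCMAlgTorusRat.of_isCMTorusRat`) and of FILE 1
`NumberFields/CMExtensionsOfEveryDegree` (every CM field `K` has CM extensions `M ⊇ K` of every relative degree).
ONE definition with a body (`powAction`, the block action — pure algebra), theorems otherwise; NO named fact (D-0026,
net debt 0), no instance, no notation.

## The print

J. S. Milne, *Complex Multiplication* (course notes, version 2020), Ch. I §3 (fetched `paper:url-8ccc30e4daab`, p. 28),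
VERBATIM: «PROPOSITION 3.6 […] (b) An isotypic abelian variety `A` has complex multiplication if and only if `End⁰(A)`
contains a field of degree `2 dim A` over `ℚ` (which can be chosen to be a CM-field invariant under some Rosati
involution). […] PROOF. […] (b) Write `A ∼ A₀^m` with `A₀` simple. Then `E₀ = End⁰(A₀)` is a CM-field. Let `F` be a
totally real field of degree `m` over `ℚ` that it linearly disjoint from `E₀`. Then `E = E₀·F` is a CM-field of
degree `2 dim A`, and the choice of an `E₀`-basis for it defines an embedding of it into `M_m(E₀) ≃ End⁰(A)`.
Moreover, (2.9) provides `A` with a polarization under which `E` is stable.»  And Remark 3.8 (p. 29): «A subalgebra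
`E` of `End⁰(A)` such that `H₁(A, ℚ)` is a free `E`-module of rank 1 need not be CM, even when it is a field. Consider,
for example, an elliptic curve `A₀` with complex multiplication by an imaginary quadratic field `E₀`, and let
`A = A₀^m`. Let `F` be any field of degree `m` over `ℚ` and linearly disjoint from `E₀` […] `E` is CM if and only if
`F` is totally real or CM».

IN THE TREE ALREADY (not restated): the bare FIELD clause of (b) — variety side
`AlgebraicGeometry/ComplexMultiplication/FieldOfDegreeTwoDimOnPowers` (p20: `B^{n+1} ⊇` a field of degree `2 dim` through
`K[X]/(X^{n+1} − c)`, which by Remark 3.8 is in general NOT CM) and torus side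
`Geometry/Kaehler/ComplexTorusEndomorphismSubfieldIsotypic` (Shimura §5.1 Prop. 3: a field of degree `2g` forces
isotypic); (c) of the Proposition — `CMAlgebraTorusRosatiStableStructure` (skel-3 gen 53); (2.9) — p19's
`CMAlgebraTorusRosatiPolarization`.  THIS FILE adds the printed parenthetical «which can be chosen to be a CM-field
invariant under some Rosati involution», at torus level, for the powers `Bⁿ` of ANY torus `B` with multiplication by a
CM field `K` of full degree (simple or not) and for every torus isogenous to such a power.

## What is proved (torus level; `h : IsCMTorusRat P ρ₀`, `K` a number field, `M ⊇ K` a finite extension with a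
## `K`-basis `b : Fin n → M`)

* §0 the one-field form of p19's polarisation theorem: `IsCMTorusRat.exists_isRiemannForm_ratGram_rosati_eq_complexConj`
  — for `K` CM there is a polarisation of `X` whose Rosati involution satisfies `ρ₀(a)† = ρ₀(ā)` («(2.9)»).
* §1 «the choice of an `E₀`-basis for it defines an embedding of it into `M_m(E₀)`»: the BLOCK ACTION
  **`powAction ρ₀ b : M →ₐ[ℚ] M_{Fin n × ι}(ℚ)`** — the regular representation `Algebra.leftMulMatrix b : M → M_n(K)`
  followed by `ρ₀` blockwise; `powAction_apply`, `powAction_algebraMap` (on `K ⊆ M` it is the DIAGONAL action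
  `diag(ρ₀ a, …, ρ₀ a)` of `K` on `Xⁿ`), `powAction_injective`.
* §2 **`IsCMTorusRat.powAction`**: `(Xⁿ, powAction ρ₀ b)` is a torus with `M`-multiplication of full degree
  (`IsCMTorusRat (powPeriod P n) (powAction ρ₀ b)`; blocks of endomorphisms are endomorphisms of `Xⁿ`,
  `[M : ℚ] = n[K : ℚ] = 2 dim Xⁿ`); `finrank_range_powAction` (the image is a field of `ℚ`-degree `2 dim Xⁿ` inside
  `End_ℚ(Xⁿ)`).
* §3 **PROPOSITION 3.6 (b), torus level — `IsCMTorusRat.exists_isCMField_powPeriod`**: for `K` a CM field and `n ≥ 1`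
  there are a CM number field `M ⊇ K` with `[M : K] = n` and `ρ : M → End_ℚ(Xⁿ)` with `IsCMTorusRat (powPeriod P n) ρ`,
  extending the diagonal action of `K`; with the polarisation clause
  **`IsCMTorusRat.exists_isCMField_powPeriod_rosati`** («(2.9) provides `A` with a polarization under which `E` is
  stable»: a Riemann form on `Xⁿ` whose Rosati involution induces complex conjugation on `ρ(M)`); subalgebra form
  `IsCMTorusRat.exists_isCMField_subalgebra_endAlgRat_powPeriod` («`End⁰(A)` contains a CM-field of degree `2 dim A`»).
* §4 «`A ∼ A₀^m`»: `IsCMTorusRat.exists_of_isIsogenous` (multiplication by `K` of full degree passes along isogenies)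
  and **`IsCMTorusRat.exists_isCMField_of_isIsogenous_powPeriod`** — every torus isogenous to `Xⁿ` has multiplication
  by a CM field of full degree, Rosati-stable for some polarisation.
* §5 validation on the CM tori of the tree: **`CMTypeLattice.exists_isCMField_powPeriod_periodEquiv`** — for a CM pair
  `(K, Φ)`, any lattice `𝔪 = ⊕ ℤμⱼ` and `n ≥ 1`, the power `(ℂ^Φ/u(𝔪))ⁿ` has multiplication by a CM field `M ⊇ K`,
  `[M : K] = n`, extending the diagonal `K` (Remark 3.8's `A = A₀^m`, with `E` now CM).

## References

* [MilneCM2006] J. S. Milne, *Complex Multiplication* (course notes), Ch. I §3 Prop. 3.6 (b) with proof, Remark 3.8,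
  Example 2.9 (pp. 28–29 of the 2020 version).
* [Shimura1998] G. Shimura, *Abelian Varieties with Complex Multiplication and Modular Functions* (1998), §5.1
  Props. 3–4 (`End_ℚ(A) = M_h(End_ℚ(B))` for `A ∼ B^h`), §6.2 Thm. 4 (3) (the Rosati involution of `E_ζ` is complex
  conjugation), §6.2 Thm. 3 and Remark (type inflation `(K; Φ) ↦ (M; Φ^M)` realised on `A^{[M:K]}`).
* [Lange2023AbelianVarietiesComplex] H. Lange, *Abelian Varieties over the Complex Numbers* (2023), §2.4.4 Cor. 2.4.26
  («`End_ℚ(X_ν^{n_ν})` equals the ring of `(n_ν × n_ν)`-matrices with entries in `End_ℚ(X_ν)`») — via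
  `ComplexTorusEndomorphismAlgebraProduct`.
-/

noncomputable section

open scoped Matrix
open Module NumberField

namespace Literature.NumberTheory.ComplexMultiplication

open Literature.Geometry.Kaehler
open Literature.Geometry.Kaehler.ComplexTorus

variable {K : Type} [Field K] [NumberField K]
variable {ι : Type} [Fintype ι] [DecidableEq ι]
variable {E : Type} [NormedAddCommGroup E] [NormedSpace ℂ E]

/-! ## §0. «(2.9)»: a polarisation whose Rosati involution is complex conjugation on `ρ₀(K)` — one-field form -/

/-- **«(2.9) provides `A` with a polarization under which `E` is stable»**, torus level, ONE CM field: for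
`h : IsCMTorusRat P ρ₀` with `K` a CM field there are a Riemann form `η` on `X` and a rational Gram matrix `G`
(`G_ℝ = latticeGram P η`) with `ρ₀(a)† = ρ₀(ā)` for every `a ∈ K` — the `Unit`-indexed case of p19's
`IsCMAlgTorusRat.exists_isRiemannForm_ratGram_rosati_eq_piComplexConj` (Shimura §6.2 Thm. 4 (3): «`E(z, T(ξ)w) =
E(T(ξ^ρ)z, w)`»). [cite: MilneCM2006, Ch. I Example 2.9 and §3 proof of Prop. 3.6 (b), p. 28] [cite: Shimura1998, §6.2 Thm. 4 (3), p. 45] -/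
theorem IsCMTorusRat.exists_isRiemannForm_ratGram_rosati_eq_complexConj [IsCMField K] {P : (ι → ℝ) ≃L[ℝ] E}
    {ρ₀ : K →ₐ[ℚ] Matrix ι ι ℚ} (h : IsCMTorusRat P ρ₀) :
    ∃ (η : E [⋀^Fin 2]→L[ℝ] ℝ) (G : Matrix ι ι ℚ), IsRiemannForm P η ∧
      G.map (Rat.cast : ℚ → ℝ) = latticeGram P η ∧ ∀ a : K, rosati G (ρ₀ a) = ρ₀ (IsCMField.complexConj K a) := by
  obtain ⟨η, G, hη, hG, hrot⟩ :=
    (IsCMAlgTorusRat.of_isCMTorusRat h).exists_isRiemannForm_ratGram_rosati_eq_piComplexConj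
  refine ⟨η, G, hη, hG, fun a => ?_⟩
  have h1 := hrot (fun _ : Unit => a)
  simpa only [AlgHom.comp_apply, Pi.evalAlgHom_apply, piComplexConj_apply] using h1

/-! ## §1. «the choice of an `E₀`-basis for it defines an embedding of it into `M_m(E₀)`»: the block action -/

section PowAction

variable {M : Type} [Field M] [CharZero M] [Algebra K M] {n : ℕ}

/-- **The block action of an extension field `M ⊇ K` on `Xⁿ`.**  For `ρ₀ : K → M_ι(ℚ)` (the rational representation
of a `K`-multiplication on `X = E/P(ℤ^ι)`) and a `K`-basis `b = (b_1, …, b_n)` of `M`, the `ℚ`-algebra homomorphism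
`M → M_{Fin n × ι}(ℚ)` sending `x` to the block matrix `(ρ₀(c_{kl}))_{k,l}`, `(c_{kl}) = leftMulMatrix b x ∈ M_n(K)`
the matrix of `y ↦ xy` — «the choice of an `E₀`-basis for it defines an embedding of it into `M_m(E₀) ≃ End⁰(A)`».
A DEFINITION (pure algebra; `M` need not be CM, cf. Remark 3.8).
[cite: MilneCM2006, Ch. I §3, proof of Prop. 3.6 (b), p. 28] -/
def powAction (ρ₀ : K →ₐ[ℚ] Matrix ι ι ℚ) (b : Basis (Fin n) K M) : M →ₐ[ℚ] Matrix (Fin n × ι) (Fin n × ι) ℚ :=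
  (Matrix.compAlgEquiv (Fin n) ι ℚ ℚ).toAlgHom.comp
    (ρ₀.mapMatrix.comp ((Algebra.leftMulMatrix b).restrictScalars ℚ))

/-- `powAction ρ₀ b x` is the block matrix of `ρ₀` applied entrywise to `leftMulMatrix b x`.
[cite: MilneCM2006, Ch. I §3, proof of Prop. 3.6 (b), p. 28] -/
theorem powAction_apply (ρ₀ : K →ₐ[ℚ] Matrix ι ι ℚ) (b : Basis (Fin n) K M) (x : M) :
    powAction ρ₀ b x = Matrix.comp (Fin n) (Fin n) ι ι ℚ ((Algebra.leftMulMatrix b x).map ρ₀) :=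
  rfl

/-- Entries of the block action: the `((k,i),(l,j))` entry is `ρ₀((leftMulMatrix b x)_{kl})_{ij}`.
[cite: MilneCM2006, Ch. I §3, proof of Prop. 3.6 (b), p. 28] -/
theorem powAction_apply_apply (ρ₀ : K →ₐ[ℚ] Matrix ι ι ℚ) (b : Basis (Fin n) K M) (x : M) (k l : Fin n)
    (i j : ι) : powAction ρ₀ b x (k, i) (l, j) = ρ₀ (Algebra.leftMulMatrix b x k l) i j :=
  rfl

/-- **On `K ⊆ M` the block action is the DIAGONAL action of `K` on `Xⁿ`**: `powAction ρ₀ b (a) = diag(ρ₀ a, …, ρ₀ a)`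
(`leftMulMatrix b (a·1) = a·1_n`). [cite: MilneCM2006, Ch. I §3, proof of Prop. 3.6 (b), p. 28] -/
theorem powAction_algebraMap (ρ₀ : K →ₐ[ℚ] Matrix ι ι ℚ) (b : Basis (Fin n) K M) (a : K) :
    powAction ρ₀ b (algebraMap K M a) =
      Matrix.comp (Fin n) (Fin n) ι ι ℚ (Matrix.diagonal fun _ : Fin n => ρ₀ a) := by
  rw [powAction_apply, (Algebra.leftMulMatrix b).commutes, Matrix.algebraMap_eq_diagonal,
    Matrix.diagonal_map (map_zero ρ₀)]
  rfl

/-- The block action is injective as soon as `ρ₀` is (a field has no proper quotients; `leftMulMatrix` is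
injective). [cite: MilneCM2006, Ch. I §3, proof of Prop. 3.6 (b), p. 28 («defines an embedding»)] -/
theorem powAction_injective {ρ₀ : K →ₐ[ℚ] Matrix ι ι ℚ} (hρ : Function.Injective ρ₀) (b : Basis (Fin n) K M) :
    Function.Injective (powAction ρ₀ b) := by
  intro x y hxy
  rw [powAction_apply, powAction_apply, (Matrix.comp (Fin n) (Fin n) ι ι ℚ).injective.eq_iff] at hxy
  have h1 : Algebra.leftMulMatrix b x = Algebra.leftMulMatrix b y := by
    ext k l
    exact hρ (congrFun (congrFun hxy k) l)
  exact Algebra.leftMulMatrix_injective b h1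

end PowAction

/-! ## §2. `(Xⁿ, powAction ρ₀ b)` is a torus with `M`-multiplication of full degree -/

namespace IsCMTorusRat

variable {P : (ι → ℝ) ≃L[ℝ] E} {ρ₀ : K →ₐ[ℚ] Matrix ι ι ℚ}
variable {M : Type} [Field M] [NumberField M] [Algebra K M] {n : ℕ}

/-- `[M : ℚ] = n · [K : ℚ]` for a `K`-basis of `M` indexed by `Fin n`. [folklore] -/
private theorem finrank_eq_mul_of_basis (b : Basis (Fin n) K M) : finrank ℚ M = n * finrank ℚ K := by
  rw [← Module.finrank_mul_finrank ℚ K M, Module.finrank_eq_card_basis b, Fintype.card_fin, mul_comm]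

/-- **`(Xⁿ, M ↪ M_n(K) ↪ M_n(End_ℚ X) = End_ℚ(Xⁿ))` is a torus with `M`-multiplication of full degree**: every block
`ρ₀(c_{kl})` is an endomorphism of `X`, so the block matrix is an endomorphism of `Xⁿ` («`End_ℚ(Xⁿ)` equals the ring
of `(n × n)`-matrices with entries in `End_ℚ(X)`», the tree's `comp_mem_endAlgRat_pow_iff`), and
`[M : ℚ] = n[K : ℚ] = n · 2 dim X = 2 dim Xⁿ` — Milne's «`E` […] of degree `2 dim A`, and the choice of an `E₀`-basis
for it defines an embedding of it into `M_m(E₀) ≃ End⁰(A)`», for ANY finite extension `M ⊇ K` (the type inflation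
`(K; Φ) ↦ (M; Φ^M)` of Shimura §6.2 Thm. 3 / Remark, realised on `A^{[M:K]}`).
[cite: MilneCM2006, Ch. I §3, proof of Prop. 3.6 (b), p. 28] [cite: Shimura1998, §6.2 Thm. 3 and Remark, pp. 42–46] -/
protected theorem powAction (h : IsCMTorusRat P ρ₀) (b : Basis (Fin n) K M) :
    IsCMTorusRat (powPeriod P n) (powAction ρ₀ b) where
  mem_endAlgRat x := by
    rw [powAction_apply, comp_mem_endAlgRat_pow_iff]
    intro k l
    rw [Matrix.map_apply]
    exact h.mem_endAlgRat _
  finrank_eq := by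
    -- `rk Λⁿ = n · #ι = n[K : ℚ]` and `rk Λⁿ = 2 dim_ℂ Eⁿ`
    have h1 : finrank ℝ (Fin n × ι → ℝ) = finrank ℝ (Fin n → E) := (powPeriod P n).toLinearEquiv.finrank_eq
    rw [finrank_fintype_fun_eq_card, finrank_real_of_complex, Fintype.card_prod, Fintype.card_fin, h.card_eq] at h1
    rw [finrank_eq_mul_of_basis b, h1]

/-- **The image `ρ(M) ⊆ End_ℚ(Xⁿ)` is a field of `ℚ`-degree `2 dim Xⁿ = n · #ι`** («`End⁰(A)` contains a field of
degree `2 dim A`»). [cite: MilneCM2006, Ch. I §3, Prop. 3.6 (b), p. 28] -/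
theorem finrank_range_powAction (h : IsCMTorusRat P ρ₀) (b : Basis (Fin n) K M) :
    finrank ℚ (powAction ρ₀ b).range = Fintype.card (Fin n × ι) := by
  haveI : Nonempty ι := h.nonempty_index
  have hinj : Function.Injective (powAction ρ₀ b) := powAction_injective ρ₀.toRingHom.injective b
  rw [← (AlgEquiv.ofInjective (powAction ρ₀ b) hinj).toLinearEquiv.finrank_eq, finrank_eq_mul_of_basis b,
    Fintype.card_prod, Fintype.card_fin, h.card_eq]

/-! ## §3. PROPOSITION 3.6 (b): `Xⁿ` has multiplication by a CM FIELD of full degree, Rosati-stable -/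

/-- **MILNE, Prop. 3.6 (b) «(which can be chosen to be a CM-field …)», torus level.**  Let `X = E/P(ℤ^ι)` be a complex
torus with multiplication `ρ₀` by a CM field `K` of full degree `[K : ℚ] = 2 dim X`, and `n ≥ 1`.  Then the power
`Xⁿ` has multiplication by a CM FIELD `M ⊇ K` of full degree `[M : ℚ] = 2 dim Xⁿ`, `[M : K] = n`, through a
`ρ : M → End_ℚ(Xⁿ)` extending the diagonal action of `K` — «`E = E₀·F` is a CM-field of degree `2 dim A`, and the
choice of an `E₀`-basis for it defines an embedding of it into `M_m(E₀) ≃ End⁰(A)`», with `M` the CM extension of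
FILE 1 (`NumberFields.exists_isCMField_extension_finrank_eq`) and `ρ` the block action `powAction`.
[cite: MilneCM2006, Ch. I §3, Prop. 3.6 (b) and proof, p. 28] -/
theorem exists_isCMField_powPeriod [IsCMField K] (h : IsCMTorusRat P ρ₀) {n : ℕ} (hn : n ≠ 0) :
    ∃ (M : Type) (_ : Field M) (_ : NumberField M) (_ : IsCMField M) (_ : Algebra K M)
      (ρ : M →ₐ[ℚ] Matrix (Fin n × ι) (Fin n × ι) ℚ),
      Module.finrank K M = n ∧ IsCMTorusRat (powPeriod P n) ρ ∧
        ∀ a : K, ρ (algebraMap K M a) = Matrix.comp (Fin n) (Fin n) ι ι ℚ (Matrix.diagonal fun _ => ρ₀ a) := by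
  obtain ⟨M, _, _, hM, _, hdeg, -⟩ := NumberFields.exists_isCMField_extension_finrank_eq K hn
  haveI : Module.Finite K M := Module.Finite.of_restrictScalars_finite ℚ K M
  let b : Basis (Fin n) K M := Module.finBasisOfFinrankEq K M hdeg
  exact ⟨M, inferInstance, inferInstance, hM, inferInstance, powAction ρ₀ b, hdeg, h.powAction b,
    fun a => powAction_algebraMap ρ₀ b a⟩

/-- **MILNE, Prop. 3.6 (b) with «Moreover, (2.9) provides `A` with a polarization under which `E` is stable»**, torus
level: as in `exists_isCMField_powPeriod`, and moreover a Riemann form `η` on `Xⁿ` (rational Gram matrix `G`) whose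
Rosati involution preserves `ρ(M)` and induces the complex conjugation of the CM field `M`: `ρ(x)† = ρ(x̄)`.
[cite: MilneCM2006, Ch. I §3, Prop. 3.6 (b) and proof, Example 2.9, p. 28] [cite: Shimura1998, §6.2 Thm. 4 (3), p. 45] -/
theorem exists_isCMField_powPeriod_rosati [IsCMField K] (h : IsCMTorusRat P ρ₀) {n : ℕ} (hn : n ≠ 0) :
    ∃ (M : Type) (_ : Field M) (_ : NumberField M) (_ : IsCMField M) (_ : Algebra K M)
      (ρ : M →ₐ[ℚ] Matrix (Fin n × ι) (Fin n × ι) ℚ) (η : (Fin n → E) [⋀^Fin 2]→L[ℝ] ℝ)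
      (G : Matrix (Fin n × ι) (Fin n × ι) ℚ),
      Module.finrank K M = n ∧ IsCMTorusRat (powPeriod P n) ρ ∧
        (∀ a : K, ρ (algebraMap K M a) = Matrix.comp (Fin n) (Fin n) ι ι ℚ (Matrix.diagonal fun _ => ρ₀ a)) ∧
        IsRiemannForm (powPeriod P n) η ∧ G.map (Rat.cast : ℚ → ℝ) = latticeGram (powPeriod P n) η ∧
        ∀ x : M, rosati G (ρ x) = ρ (IsCMField.complexConj M x) := by
  obtain ⟨M, _, _, hM, _, ρ, hdeg, hρ, hdiag⟩ := h.exists_isCMField_powPeriod hn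
  haveI : IsCMField M := hM
  obtain ⟨η, G, hη, hG, hrot⟩ := hρ.exists_isRiemannForm_ratGram_rosati_eq_complexConj
  exact ⟨M, inferInstance, inferInstance, hM, inferInstance, ρ, η, G, hdeg, hρ, hdiag, hη, hG, hrot⟩

/-- **«`End⁰(A)` contains a CM-field of degree `2 dim A`»** for `A = Xⁿ`, in subalgebra form: there is a subalgebra
`T ≤ End_ℚ(Xⁿ)` which is a FIELD of `ℚ`-degree `2 dim Xⁿ = #(Fin n × ι)`, isomorphic to a CM number field.
[cite: MilneCM2006, Ch. I §3, Prop. 3.6 (b), p. 28] -/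
theorem exists_isCMField_subalgebra_endAlgRat_powPeriod [IsCMField K] (h : IsCMTorusRat P ρ₀) {n : ℕ}
    (hn : n ≠ 0) :
    ∃ T : Subalgebra ℚ (Matrix (Fin n × ι) (Fin n × ι) ℚ), T ≤ endAlgRat (powPeriod P n) ∧ IsField T ∧
      finrank ℚ T = Fintype.card (Fin n × ι) ∧
      ∃ (M : Type) (_ : Field M) (_ : NumberField M) (_ : IsCMField M), Nonempty (M ≃ₐ[ℚ] T) := by
  obtain ⟨M, _, _, hM, _, hdeg, -⟩ := NumberFields.exists_isCMField_extension_finrank_eq K hn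
  haveI : Module.Finite K M := Module.Finite.of_restrictScalars_finite ℚ K M
  haveI : Nonempty ι := h.nonempty_index
  let b : Basis (Fin n) K M := Module.finBasisOfFinrankEq K M hdeg
  have hinj : Function.Injective (powAction ρ₀ b) := powAction_injective ρ₀.toRingHom.injective b
  let e : M ≃ₐ[ℚ] (powAction ρ₀ b).range := AlgEquiv.ofInjective (powAction ρ₀ b) hinj
  refine ⟨(powAction ρ₀ b).range, ?_, MulEquiv.isField (Field.toIsField M) e.symm.toMulEquiv,
    h.finrank_range_powAction b, M, inferInstance, inferInstance, hM, ⟨e⟩⟩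
  rintro y ⟨x, rfl⟩
  exact (h.powAction b).mem_endAlgRat x

/-! ## §4. «Write `A ∼ A₀^m`»: tori isogenous to `Xⁿ` -/

variable {ι₂ : Type} [Fintype ι₂] [DecidableEq ι₂] {E₂ : Type} [NormedAddCommGroup E₂] [NormedSpace ℂ E₂]
variable {P₂ : (ι₂ → ℝ) ≃L[ℝ] E₂}

/-- **Multiplication by `K` of full degree passes along isogenies**: an isogeny `X ∼ X₂` induces
`End_ℚ(X) ≅ End_ℚ(X₂)` (the tree's `IsIsogenous.nonempty_endAlgRatEquiv`) and `rk Λ = rk Λ₂`; transporting `ρ₀`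
gives `IsCMTorusRat` on `X₂` (Milne's «Write `A ∼ A₀^m`»: the statement of Prop. 3.6 only depends on `A` up to
isogeny). [cite: MilneCM2006, Ch. I §3, proof of Prop. 3.6 (b), p. 28] [cite: Lange2023AbelianVarietiesComplex, §2.4.4 Cor. 2.4.26 (proof)] -/
theorem exists_of_isIsogenous (h : IsCMTorusRat P ρ₀) (h12 : IsIsogenous P P₂) :
    ∃ ρ₂ : K →ₐ[ℚ] Matrix ι₂ ι₂ ℚ, IsCMTorusRat P₂ ρ₂ ∧
      ∃ e : endAlgRat P ≃ₐ[ℚ] endAlgRat P₂, ∀ a : K, ρ₂ a = (e ⟨ρ₀ a, h.mem_endAlgRat a⟩ : Matrix ι₂ ι₂ ℚ) := by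
  obtain ⟨e⟩ := h12.nonempty_endAlgRatEquiv
  refine ⟨(endAlgRat P₂).val.comp (e.toAlgHom.comp (ρ₀.codRestrict (endAlgRat P) h.mem_endAlgRat)),
    ⟨fun a => (e _).2, ?_⟩, e, fun a => rfl⟩
  have h1 : finrank ℝ (ι → ℝ) = finrank ℝ E := P.toLinearEquiv.finrank_eq
  have h2 : finrank ℝ (ι₂ → ℝ) = finrank ℝ E₂ := P₂.toLinearEquiv.finrank_eq
  rw [finrank_fintype_fun_eq_card, finrank_real_of_complex] at h1 h2
  have h3 := h12.card_eq
  rw [h.finrank_eq]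
  omega

/-- **MILNE, Prop. 3.6 (b) for every torus isogenous to `Xⁿ`** («Write `A ∼ A₀^m` with `A₀` simple. Then
`E₀ = End⁰(A₀)` is a CM-field …»): if `X₂ ∼ Xⁿ` with `X` carrying multiplication by a CM field `K` of full degree, then
`X₂` has multiplication by a CM field `M ⊇ K`, `[M : K] = n`, of full degree, and a polarisation whose Rosati involution
induces complex conjugation on it. [cite: MilneCM2006, Ch. I §3, Prop. 3.6 (b) and proof, p. 28] -/
theorem exists_isCMField_of_isIsogenous_powPeriod [IsCMField K] (h : IsCMTorusRat P ρ₀) {n : ℕ} (hn : n ≠ 0)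
    (h12 : IsIsogenous P₂ (powPeriod P n)) :
    ∃ (M : Type) (_ : Field M) (_ : NumberField M) (_ : IsCMField M) (_ : Algebra K M)
      (ρ : M →ₐ[ℚ] Matrix ι₂ ι₂ ℚ) (η : E₂ [⋀^Fin 2]→L[ℝ] ℝ) (G : Matrix ι₂ ι₂ ℚ),
      Module.finrank K M = n ∧ IsCMTorusRat P₂ ρ ∧ IsRiemannForm P₂ η ∧
        G.map (Rat.cast : ℚ → ℝ) = latticeGram P₂ η ∧ ∀ x : M, rosati G (ρ x) = ρ (IsCMField.complexConj M x) := by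
  obtain ⟨M, _, _, hM, _, ρ, hdeg, hρ, -⟩ := h.exists_isCMField_powPeriod hn
  haveI : IsCMField M := hM
  obtain ⟨ρ₂, hρ₂, -⟩ := hρ.exists_of_isIsogenous (IsIsogenous.symm _ _ h12)
  obtain ⟨η, G, hη, hG, hrot⟩ := hρ₂.exists_isRiemannForm_ratGram_rosati_eq_complexConj
  exact ⟨M, inferInstance, inferInstance, hM, inferInstance, ρ₂, η, G, hdeg, hρ₂, hη, hG, hrot⟩

end IsCMTorusRat

/-! ## §5. Validation: the powers `(ℂ^Φ/u(𝔪))ⁿ` of the CM tori of the tree (Remark 3.8's `A = A₀^m`, `E` now CM) -/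

namespace CMTypeLattice

open Literature.AlgebraicGeometry.Motives (CMType)
open Literature.AlgebraicGeometry.ComplexMultiplication (CMTorus.periodEquiv)

open scoped Classical in
/-- **Validation / non-vacuity on the tree's CM tori**: for a CM pair `(K, Φ)`, a lattice `𝔪 = ⊕ⱼ ℤμⱼ ⊂ K` and
`n ≥ 1`, the power `(ℂ^Φ/u(𝔪))ⁿ` — Remark 3.8's `A = A₀^m` — carries multiplication by a CM FIELD `M ⊇ K` with
`[M : K] = n` of full degree, extending the diagonal multiplication `diag(M_a)` by `K` (from `isCMTorusRat_periodEquiv`,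
Shimura §6.2 Thm. 3, and §3 above; the polarisation clause is `IsCMTorusRat.exists_isCMField_powPeriod_rosati`).
[cite: MilneCM2006, Ch. I §3, Prop. 3.6 (b) and Remark 3.8, pp. 28–29] [cite: Shimura1998, §6.2 Thm. 3, p. 42] -/
theorem exists_isCMField_powPeriod_periodEquiv [IsCMField K] (Φ : CMType K) (μ : Basis ι ℚ K) {n : ℕ}
    (hn : n ≠ 0) :
    ∃ (M : Type) (_ : Field M) (_ : NumberField M) (_ : IsCMField M) (_ : Algebra K M)
      (ρ : M →ₐ[ℚ] Matrix (Fin n × ι) (Fin n × ι) ℚ),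
      Module.finrank K M = n ∧ IsCMTorusRat (powPeriod (E := Φ.1 → ℂ) (CMTorus.periodEquiv Φ μ) n) ρ ∧
        ∀ a : K, ρ (algebraMap K M a) =
          Matrix.comp (Fin n) (Fin n) ι ι ℚ (Matrix.diagonal fun _ => Algebra.leftMulMatrix μ a) :=
  (isCMTorusRat_periodEquiv Φ μ).exists_isCMField_powPeriod hn

end CMTypeLattice

end Literature.NumberTheory.ComplexMultiplication

end
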